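import Literature.AlgebraicGeometry.ModuliOfAbelianVarieties.SiegelModuliDatum
import Literature.NumberTheory.ModularForms.SiegelUpperHalfSpaceLevelCovering
import Literature.NumberTheory.ModularForms.SiegelSymplecticVolume
import Literature.NumberTheory.Transcendental.AnalytificationLocalBiholomorphism
import Literature.NumberTheory.Transcendental.AnalytificationExistenceProofs
import Literature.AlgebraicGeometry.Motives.AbelianVarietyProofs
import HarnessLib

/-!
# The Siegel uniformisation `𝔥_g → Γ_δ(N)\𝔥_g = S(ℂ)` is a local biholomorphism; `dim S = g(g+1)/2`

Topic `Literature/AlgebraicGeometry/ModuliOfAbelianVarieties`, namespace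
`Literature.AlgebraicGeometry.ModuliOfAbelianVarieties` (grouping sub-namespace `SiegelModuliDatum`).
THEOREMS ONLY.

For a Siegel fine moduli datum `D : SiegelModuliDatum g δ N` (★ `SiegelModuliDatum`: base `D.S`
smooth, irreducible, quasi-projective; uniformisation `D.unif : 𝔥_g → S(ℂ)` continuous, open, onto,
with fibres the `Γ_δ(N)`-orbits and holomorphic in algebraic coordinates) with `δ_i ≥ 1` and
`N ≥ 3`, the tree knows that `𝔥_g → S(ℂ)` is a covering map, hence a local homeomorphism
(`SiegelModuliDatumCovering.isLocalHomeomorph_restrict_unif`, from Minkowski's torsion-freeness of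
`Γ_δ(N)` and the proper discontinuity of `Sp_{2g}(ℤ)` on `𝔥_g`).  Reading `𝔥_g` in Klingen's
coordinates `ℂ^{g(g+1)/2} = (Sym2 (Fin g) → ℂ)` (`SiegelUpperHalfSpace.siegelUpperHalfSpaceCoord`,
an OPEN set; `SiegelUpperHalfSpace.coordUHSHomeomorph`), the generic
`IsAnalytification.bijective_mfderiv_symm_comp` (holomorphic local homeomorphism into an
analytification ⇒ local biholomorphism, Clements–Osgood + Brouwer) gives:

* `SiegelModuliDatum.isLocalHomeomorph_restrict_unif_coord` — the coordinate uniformisation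
  `v ↦ unif (Z(v))` restricted to `𝔥_g ⊆ ℂ^{g(g+1)/2}` is a local homeomorphism into `S(ℂ)`;
* `SiegelModuliDatum.differentiableOn_unif_coord` — it is holomorphic in algebraic coordinates;
* `SiegelModuliDatum.eq_dim_of_isAnalytification` — ANY analytification of `D.S` has dimension
  `m = g(g+1)/2`, and `SiegelModuliDatum.smoothOfRelativeDimension_base` — **`D.S` is smooth of
  relative dimension `g(g+1)/2` over `ℂ`** ([MumfordFogartyKirwan1994] App. 7A «`𝒜 × Spec ℂ ≅ 𝔥_g/Γ_n`»;
  [GenestierNgo2020] Prop. 1.3.2), a clause the hypothesis structure does not record;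
* `SiegelModuliDatum.mdifferentiableAt_unif_lift` / `SiegelModuliDatum.bijective_mfderiv_unif_lift`
  — for every analytification `ψ : M' → S(ℂ)` with holomorphic atlas, the lift `ψ⁻¹ ∘ unif ∘ Z(·)`
  is holomorphic on `𝔥_g` with bijective differential at every point («`𝒜⁰_{g,N}` is a smooth
  complex analytic space» uniformised by `𝔥_g`).

Consumers: `stub_S2imm` of the I-1′ receptacle line (cell hodgecm-mathlib): the analytic
differential of a morphism into the Siegel modular variety is computed through `unif`.

## References

* [GenestierNgo2020] A. Genestier, B. C. Ngô, *Lectures on Shimura varieties*, Prop. 1.3.2.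
* [MumfordFogartyKirwan1994] D. Mumford, J. Fogarty, F. Kirwan, *GIT*, Appendix to Ch. 7, §A.
* [Klingen1990] H. Klingen, *Introductory lectures on Siegel modular forms*, Ch. I §1 Def. 2.
* [FritzscheGrauert2002] K. Fritzsche, H. Grauert, *From Holomorphic Functions to Complex
  Manifolds*, Ch. I §8 Thm. 8.5.
-/

noncomputable section

open Set Function Filter TopologicalSpace CategoryTheory AlgebraicGeometry Matrix
open scoped Manifold ContDiff Topology Matrix.Norms.Elementwise

namespace Literature.AlgebraicGeometry.ModuliOfAbelianVarieties

open Literature.AlgebraicGeometry.Motives (ComplexPoints AlgPoints SchemeOver)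
open Literature.AlgebraicGeometry.Motives.AlgPoints
open Literature.AlgebraicGeometry.HodgeTheory (IsQuasiProjectiveOver)
open Literature.NumberTheory.Automorphic (siegelUpperHalfSpace mem_siegelUpperHalfSpace_iff)
open Literature.NumberTheory.ModularForms.SiegelUpperHalfSpace (siegelUpperHalfSpaceCoord coordCLE
  coordUHSHomeomorph isOpen_siegelUpperHalfSpaceCoord mem_siegelUpperHalfSpaceCoord_iff)
open Literature.NumberTheory.ModularForms (SiegelModuliDatumCovering.isLocalHomeomorph_restrict_unif)
open Literature.NumberTheory.Transcendental
open Literature.LinearAlgebra.Matrix (symmetricSubmodule)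

namespace SiegelModuliDatum

variable {g : ℕ} {δ : Fin g → ℕ} {N : ℕ} (D : SiegelModuliDatum g δ N)

/-! ### §1. The uniformisation in Klingen's coordinates `ℂ^{g(g+1)/2}` -/

/-- The symmetric matrix `Z(v)` with Klingen coordinates `v` lies in `𝔥_g` for
`v ∈ siegelUpperHalfSpaceCoord g` (definition of the coordinate set).
[cite: Klingen1990, Ch. I §1 Def. 2 (p. 2)] -/
theorem coe_coordCLE_symm_mem {v : Sym2 (Fin g) → ℂ} (hv : v ∈ siegelUpperHalfSpaceCoord g) :
    (((coordCLE g).symm v : symmetricSubmodule (Fin g) ℂ) : Matrix (Fin g) (Fin g) ℂ) ∈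
      siegelUpperHalfSpace g :=
  (mem_siegelUpperHalfSpaceCoord_iff).1 hv

/-- The coordinate uniformisation restricted to `𝔥_g ⊆ ℂ^{g(g+1)/2}` is the tree's restricted
uniformisation `𝔥_g → S(ℂ)` precomposed with the coordinate homeomorphism
`SiegelUpperHalfSpace.coordUHSHomeomorph`. [cite: Klingen1990, Ch. I §1 Def. 2 (p. 2)] -/
theorem restrict_unif_coord_eq :
    (siegelUpperHalfSpaceCoord g).restrict
        (fun v ↦ D.unif (((coordCLE g).symm v : symmetricSubmodule (Fin g) ℂ) :
          Matrix (Fin g) (Fin g) ℂ)) =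
      (siegelUpperHalfSpace g).restrict D.unif ∘ (coordUHSHomeomorph g).symm := by
  funext v
  rfl

/-- **`𝔥_g ⊆ ℂ^{g(g+1)/2} → S(ℂ)` is a local homeomorphism** (`δ_i ≥ 1`, `N ≥ 3`): the covering
`𝔥_g → Γ_δ(N)\𝔥_g = S(ℂ)` read in Klingen's coordinates.
[cite: GenestierNgo2020, Prop. 1.3.2] -/
theorem isLocalHomeomorph_restrict_unif_coord (hδ : ∀ i, 0 < δ i) (hN : 3 ≤ N) :
    IsLocalHomeomorph ((siegelUpperHalfSpaceCoord g).restrict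
      (fun v ↦ D.unif (((coordCLE g).symm v : symmetricSubmodule (Fin g) ℂ) :
        Matrix (Fin g) (Fin g) ℂ))) := by
  rw [restrict_unif_coord_eq]
  exact (SiegelModuliDatumCovering.isLocalHomeomorph_restrict_unif D hδ hN).comp
    (coordUHSHomeomorph g).symm.isLocalHomeomorph

/-- **The coordinate uniformisation is holomorphic in algebraic coordinates**: every regular
function on an affine open `U ⊆ S`, read through `v ↦ unif (Z(v))`, is holomorphic on the open
part of `𝔥_g ⊆ ℂ^{g(g+1)/2}` above `U` (field `differentiableOn_unif`, composed with the linear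
coordinate map). [cite: CharlesSchnell2014Notes, Thm. 11.5.10 (p. 516)] -/
theorem differentiableOn_unif_coord (U : D.S.left.affineOpens)
    (s : D.S.left.presheaf.obj (Opposite.op (↑U : D.S.left.Opens))) :
    DifferentiableOn ℂ
      (fun v : Sym2 (Fin g) → ℂ ↦ evalOrZero (↑U : D.S.left.Opens) s
        (D.unif (((coordCLE g).symm v : symmetricSubmodule (Fin g) ℂ) : Matrix (Fin g) (Fin g) ℂ)))
      (siegelUpperHalfSpaceCoord g ∩
        (fun v ↦ D.unif (((coordCLE g).symm v : symmetricSubmodule (Fin g) ℂ) :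
          Matrix (Fin g) (Fin g) ℂ)) ⁻¹' {P | P.pt ∈ (↑U : D.S.left.Opens)}) := by
  set L : (Sym2 (Fin g) → ℂ) →L[ℂ] Matrix (Fin g) (Fin g) ℂ :=
    (symmetricSubmodule (Fin g) ℂ).subtypeL.comp ((coordCLE g).symm : _ →L[ℂ] _) with hL
  have hLv : ∀ v, L v = (((coordCLE g).symm v : symmetricSubmodule (Fin g) ℂ) :
      Matrix (Fin g) (Fin g) ℂ) := fun v ↦ rfl
  have hmaps : MapsTo L
      (siegelUpperHalfSpaceCoord g ∩
        (fun v ↦ D.unif (((coordCLE g).symm v : symmetricSubmodule (Fin g) ℂ) :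
          Matrix (Fin g) (Fin g) ℂ)) ⁻¹' {P | P.pt ∈ (↑U : D.S.left.Opens)})
      (siegelUpperHalfSpace g ∩ D.unif ⁻¹' {P | P.pt ∈ (↑U : D.S.left.Opens)}) := by
    intro v hv
    refine ⟨?_, ?_⟩
    · rw [hLv]; exact coe_coordCLE_symm_mem hv.1
    · show (D.unif (L v)).pt ∈ (↑U : D.S.left.Opens)
      rw [hLv]; exact hv.2
  have hcomp := (D.differentiableOn_unif U s).comp L.differentiableOn hmaps
  refine hcomp.congr fun v _ ↦ ?_
  simp only [Function.comp_apply, hLv]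

/-! ### §2. Dimension and local biholomorphy against any analytification of the base -/

section Analytification

variable {E' : Type*} [NormedAddCommGroup E'] [NormedSpace ℂ E'] [FiniteDimensional ℂ E']
  {M' : Type*} [TopologicalSpace M'] [ChartedSpace E' M'] {m : ℕ} {ψ : M' → ComplexPoints D.S}

/-- **Any analytification of the Siegel moduli base has dimension `g(g+1)/2`** (`δ_i ≥ 1`,
`N ≥ 3`): the local homeomorphism `𝔥_g ⊆ ℂ^{g(g+1)/2} → S(ℂ) ≃ M'` and Brouwer's invariance of
dimension (`IsAnalytification.finrank_eq_of_isLocalHomeomorph_restrict`), with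
`dim ℂ^{g(g+1)/2} = (g+1 choose 2)`. [cite: MumfordFogartyKirwan1994, Appendix to Ch. 7 §A]
[cite: GenestierNgo2020, Prop. 1.3.2] -/
theorem eq_dim_of_isAnalytification (hδ : ∀ i, 0 < δ i) (hN : 3 ≤ N)
    (hψ : IsAnalytification E' D.S m ψ) : m = g * (g + 1) / 2 := by
  have hne : (siegelUpperHalfSpaceCoord g).Nonempty := by
    obtain ⟨Z⟩ := (inferInstance : Nonempty (siegelUpperHalfSpace g))
    exact ⟨coordUHSHomeomorph g Z, (coordUHSHomeomorph g Z).2⟩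
  have h := hψ.finrank_eq_of_isLocalHomeomorph_restrict isOpen_siegelUpperHalfSpaceCoord hne
    (D.isLocalHomeomorph_restrict_unif_coord hδ hN)
  rw [← h, Module.finrank_fintype_fun_eq_card, Sym2.card, Fintype.card_fin, Nat.choose_two_right,
    Nat.add_sub_cancel, mul_comm]

/-- **The lift of the Siegel uniformisation to an analytification is holomorphic**: for every
analytification `ψ : M' → S(ℂ)` with holomorphic atlas, `ψ⁻¹ ∘ unif ∘ Z(·)` is holomorphic at
every point of `𝔥_g ⊆ ℂ^{g(g+1)/2}` (holomorphy into `S^an` is tested on regular functions).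
[cite: GenestierNgo2020, Prop. 1.3.2] -/
theorem mdifferentiableAt_unif_lift [SmoothOfRelativeDimension m D.S.hom]
    [IsManifold 𝓘(ℂ, E') ω M'] (hδ : ∀ i, 0 < δ i) (hN : 3 ≤ N)
    (hψ : IsAnalytification E' D.S m ψ) {v : Sym2 (Fin g) → ℂ} (hv : v ∈ siegelUpperHalfSpaceCoord g) :
    MDifferentiableAt 𝓘(ℂ, Sym2 (Fin g) → ℂ) 𝓘(ℂ, E')
      (hψ.homeomorph.symm ∘ fun v ↦ D.unif
        (((coordCLE g).symm v : symmetricSubmodule (Fin g) ℂ) : Matrix (Fin g) (Fin g) ℂ)) v :=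
  hψ.mdifferentiableAt_symm_comp_of_isLocalHomeomorph isOpen_siegelUpperHalfSpaceCoord
    (D.isLocalHomeomorph_restrict_unif_coord hδ hN) (D.differentiableOn_unif_coord) hv

/-- **The Siegel uniformisation is a local biholomorphism onto `S^an`** (`δ_i ≥ 1`, `N ≥ 3`): for
every analytification `ψ : M' → S(ℂ)` with holomorphic atlas, the differential of the lift
`ψ⁻¹ ∘ unif ∘ Z(·) : 𝔥_g → M'` is bijective at every point of `𝔥_g ⊆ ℂ^{g(g+1)/2}` («the quotient
`𝒜⁰_{g,N}` is a smooth complex analytic space» uniformised by `𝔥_g`; Clements–Osgood).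
[cite: GenestierNgo2020, Prop. 1.3.2] [cite: FritzscheGrauert2002, Ch. I §8 Thm. 8.5] -/
theorem bijective_mfderiv_unif_lift [SmoothOfRelativeDimension m D.S.hom]
    [IsManifold 𝓘(ℂ, E') ω M'] (hδ : ∀ i, 0 < δ i) (hN : 3 ≤ N)
    (hψ : IsAnalytification E' D.S m ψ) {v : Sym2 (Fin g) → ℂ} (hv : v ∈ siegelUpperHalfSpaceCoord g) :
    Function.Bijective (mfderiv 𝓘(ℂ, Sym2 (Fin g) → ℂ) 𝓘(ℂ, E')
      (hψ.homeomorph.symm ∘ fun v ↦ D.unif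
        (((coordCLE g).symm v : symmetricSubmodule (Fin g) ℂ) : Matrix (Fin g) (Fin g) ℂ)) v) :=
  hψ.bijective_mfderiv_symm_comp isOpen_siegelUpperHalfSpaceCoord
    (D.isLocalHomeomorph_restrict_unif_coord hδ hN) (D.differentiableOn_unif_coord) hv

/-- Injectivity half of `bijective_mfderiv_unif_lift` (the form `stub_S2imm` consumes).
[cite: FritzscheGrauert2002, Ch. I §8 Thm. 8.5] -/
theorem injective_mfderiv_unif_lift [SmoothOfRelativeDimension m D.S.hom]
    [IsManifold 𝓘(ℂ, E') ω M'] (hδ : ∀ i, 0 < δ i) (hN : 3 ≤ N)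
    (hψ : IsAnalytification E' D.S m ψ) {v : Sym2 (Fin g) → ℂ} (hv : v ∈ siegelUpperHalfSpaceCoord g) :
    Function.Injective (mfderiv 𝓘(ℂ, Sym2 (Fin g) → ℂ) 𝓘(ℂ, E')
      (hψ.homeomorph.symm ∘ fun v ↦ D.unif
        (((coordCLE g).symm v : symmetricSubmodule (Fin g) ℂ) : Matrix (Fin g) (Fin g) ℂ)) v) :=
  (D.bijective_mfderiv_unif_lift hδ hN hψ hv).1

end Analytification

/-! ### §3. The base is smooth of relative dimension `g(g+1)/2` -/

/-- A quasi-projective `ℂ`-scheme is separated over `ℂ` (private twin of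
`HodgeTheory.IsQuasiProjectiveOver.isSeparated`, whose module is too heavy to import here).
[cite: Hartshorne1977, II Thm. 4.9] -/
private theorem isSeparated_of_isQuasiProjectiveOver {T : SchemeOver ℂ} (hT : IsQuasiProjectiveOver T) :
    IsSeparated T.hom := by
  obtain ⟨P, j, hP, hj⟩ := hT
  haveI := hj
  haveI : IsProper P.hom := hP.isProper
  rw [← Over.w j]
  infer_instance

/-- A quasi-projective `ℂ`-scheme is locally of finite type over `ℂ` (private twin of
`HodgeTheory.IsQuasiProjectiveOver.locallyOfFiniteType`). [cite: Hartshorne1977, II Thm. 4.9] -/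
private theorem locallyOfFiniteType_of_isQuasiProjectiveOver {T : SchemeOver ℂ}
    (hT : IsQuasiProjectiveOver T) : LocallyOfFiniteType T.hom := by
  obtain ⟨P, j, hP, hj⟩ := hT
  haveI : IsProper P.hom := hP.isProper
  rw [show T.hom = j.left ≫ P.hom from (Over.w j).symm]
  infer_instance

/-- The base `D.S` of a Siegel fine moduli datum is separated over `ℂ` (it is quasi-projective).
[cite: MumfordFogartyKirwan1994, Ch. 7 Thm. 7.9] -/
theorem isSeparated_base : IsSeparated D.S.hom :=
  isSeparated_of_isQuasiProjectiveOver D.isQuasiProjectiveOver_base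

/-- The base `D.S` of a Siegel fine moduli datum is locally of finite type over `ℂ`.
[cite: MumfordFogartyKirwan1994, Ch. 7 Thm. 7.9] -/
theorem locallyOfFiniteType_base : LocallyOfFiniteType D.S.hom :=
  locallyOfFiniteType_of_isQuasiProjectiveOver D.isQuasiProjectiveOver_base

/-- The base `D.S` is smooth of SOME relative dimension over `ℂ` (smooth with irreducible source).
[cite: MumfordFogartyKirwan1994, Ch. 7 Thm. 7.9] -/
theorem exists_smoothOfRelativeDimension_base : ∃ d : ℕ, SmoothOfRelativeDimension d D.S.hom := by
  haveI := D.irreducibleSpace_base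
  haveI := D.smooth_base
  exact Literature.AlgebraicGeometry.Motives.exists_smoothOfRelativeDimension_of_smooth D.S.hom

/-- **`dim S = g(g+1)/2`: the base of a Siegel fine moduli datum of type `δ` (`δ_i ≥ 1`) and level
`N ≥ 3` is smooth of relative dimension `g(g+1)/2` over `ℂ`** — the only relative dimension `d`
with `SmoothOfRelativeDimension d D.S.hom` is `g(g+1)/2`, since an analytification of dimension `d`
exists (`exists_isAnalytification_holds`) and every analytification has dimension `g(g+1)/2`
(`eq_dim_of_isAnalytification`). [cite: MumfordFogartyKirwan1994, Appendix to Ch. 7 §A]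
[cite: GenestierNgo2020, Prop. 1.3.2 and Thm. 2.3.1] -/
theorem smoothOfRelativeDimension_base (hδ : ∀ i, 0 < δ i) (hN : 3 ≤ N) :
    SmoothOfRelativeDimension (g * (g + 1) / 2) D.S.hom := by
  obtain ⟨d, hd⟩ := D.exists_smoothOfRelativeDimension_base
  haveI := hd
  haveI := D.isSeparated_base
  haveI := D.locallyOfFiniteType_base
  obtain ⟨M, _, _, _, _, φ, hφ⟩ := exists_isAnalytification_holds D.S d
  rw [← D.eq_dim_of_isAnalytification hδ hN hφ]
  exact hd

/-- If `D.S` is smooth of relative dimension `d`, then `d = g(g+1)/2` (uniqueness of the relative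
dimension, read through an analytification). [cite: GenestierNgo2020, Prop. 1.3.2] -/
theorem eq_dim_of_smoothOfRelativeDimension (hδ : ∀ i, 0 < δ i) (hN : 3 ≤ N) {d : ℕ}
    [SmoothOfRelativeDimension d D.S.hom] : d = g * (g + 1) / 2 := by
  haveI := D.isSeparated_base
  haveI := D.locallyOfFiniteType_base
  obtain ⟨M, _, _, _, _, φ, hφ⟩ := exists_isAnalytification_holds D.S d
  exact D.eq_dim_of_isAnalytification hδ hN hφ

end SiegelModuliDatum

end Literature.AlgebraicGeometry.ModuliOfAbelianVarieties
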